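import Summits.CriticalPhenomena.PercolationContinuityZ3.Theorems.FK.RandomClusterEdgeCountChernoff
import Summits.CriticalPhenomena.PercolationContinuityZ3.Theorems.FK.PressureUniquenessCriterion
import Summits.CriticalPhenomena.PercolationContinuityZ3.Theorems.FK.MagnetizationLargeDeviations
import HarnessLib

/-!
# LARGE DEVIATIONS OF THE NUMBER OF OPEN EDGES OF THE RANDOM-CLUSTER MODEL, II: `ℤ^d` BOXES — THE LD UPPER BOUND WITH THE CONVEX
# `π`-PRESSURE, AND NO EDGE DENSITY ABOVE `h¹(p,q)` OR BELOW `h⁰(p,q)` AT VOLUME ORDER, UNDER FREE AND WIRED BOUNDARY CONDITIONS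
# (Grimmett 2006 Thm. (4.58), (4.72)–(4.78), Thm. (4.63); Ellis 2006 Thm. II.6.1 / II.6.3)

Claimed R42 (8)(c) in the cell INBOX at 2026-08-29T12:35:52Z by fkp-10a gen 360 (NEW CLAIM #3 of the gen), addressed to coordinator fk-4 gen 299 (seated 12:03Z 2026-08-29; R182 / R183 in force; ruling R184 requested); lineage row FO-10a-g360r (self-suggested), package g360-rcld, label RC-B.
Helper file of the `fk-continuity` build cell (bschramm lane; `--supports stmt-CriticalPhenomena-4575`; fkp-10a gen 360,
package g360-rcld, label RC-B); builds on p205010 (kernel theorem, internal audit signed; external expert review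
pending). No definitions, no named facts, no sorries; standard axioms.
UNCONDITIONAL (random-cluster measures `φ^b_{Λ_N,p,q}` of the boxes `Λ_N = {−N,…,N}^d ⊆ ℤ^d` with free (`b = false`) or wired
(`b = true`) boundary condition — the tree's `rcMeasure (finsetGraph (zdGraph d) (box d N)) p q (boxBC d b N)` = `rcBoxMeasure d b p q N`;
`q ≥ 1`, `0 < p < 1`; `Φ` = ANY per-site pressure function, `|Λ_N|⁻¹ log Z⁰_{Λ_N}(x,q) → Φ(x)` on `(0,1)` (exists: `exists_rcPressure`; the
main theorems discharge it); `h⁰ = freeEdgeDensity`, `h¹ = wiredEdgeDensity` at a lattice edge `e₀`; `|ω|` = number of open edges).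
Scope: volume-order UPPER bounds for the tails of `|ω|/|Λ_N|` (no lower LD bound, no statement between `h⁰` and `h¹`, nothing at or
about `p_c(q)`, nothing on FH / TP_FK); nothing percolation-bearing.

With `L_N(x) = log Z^b_{Λ_N}(x,q) − |E_{Λ_N}| log(1−x)` (so `|Λ_N|⁻¹ L_N(x) → Φ(x) − d log(1−x) =: F(x)`, `tendsto_logY_box_div`, a convex
function of `π = log(x/(1−x))` by `convexOn_pressure_logistic'`) and `t = log(p'(1−p)/(p(1−p')))`:

* **`rc_ld_upper_box`** / `rc_ld_lower_box` — THE LD UPPER BOUNDS: for `p ≤ p'` (resp. `p' ≤ p`), every `m`, `ε > 0`, both `b`,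
  eventually `φ^b_{Λ_N,p,q}{m|Λ_N| ≤ |ω|} ≤ exp(−|Λ_N|(tm − (F(p') − F(p)) − ε))` (resp. `{|ω| ≤ m|Λ_N|}`) — Ellis' Thm. II.6.1 (b) with
  the free-energy functional `F(p') − F(p)` of the exponential family (file I);
* `exists_Ioo_pos_of_hasDerivWithinAt_Ioi` / `_Iio`, `log_ratio_eq_logit_sub`, **`exists_rate_pos_of_lt`** / `exists_rate_pos_of_gt` —
  from the ONE-SIDED derivatives `Φ'(p±) = d(h^{1/0}(p,q) − p)/(p(1−p))` (`hasDerivWithinAt_pressure_Ioi'/Iio'`, Grimmett (4.77)):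
  some rate is positive as soon as `m > d·h¹(p,q)` (resp. `m < d·h⁰(p,q)`);
* **`rc_upper_tail_exp_decay`** / **`rc_lower_tail_exp_decay`** — NO EDGE DENSITY ABOVE `h¹` OR BELOW `h⁰` AT VOLUME ORDER: for
  `q ≥ 1`, `p ∈ (0,1)`, `m > d·h¹(p,q)` (resp. `m < d·h⁰(p,q)`) there is `c > 0` with `φ^b_{Λ_N,p,q}{m|Λ_N| ≤ |ω|} ≤ e^{−c|Λ_N|}`
  (resp. `{|ω| ≤ m|Λ_N|}`) eventually, for BOTH boundary conditions (`Φ` discharged inside);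
* **`rc_exp_concentration_of_edgeDensity_eq`** — where `h⁰(p,q) = h¹(p,q)` (all but countably many `p`; equivalently `Φ` differentiable
  at `p`, Thm. (4.63)), the edge density `|ω|/|Λ_N|` concentrates EXPONENTIALLY at `d·h(p,q)` under both boundary conditions
  (Ellis Thm. II.6.3).

## References

* G. Grimmett, *The Random-Cluster Model*, Springer (2006), §4.5 Thm. (4.58), (4.70)–(4.78), Thm. (4.63). [Grimmett2006]
* R. S. Ellis, *Entropy, Large Deviations, and Statistical Mechanics*, Springer (2006), Thm. II.6.1, Thm. II.6.3, §VII.3.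
  [Ellis2006]
-/

noncomputable section

namespace Summit.CriticalPhenomena.PercolationContinuityZ3.Theorems.FK

namespace RandomClusterLargeDeviations

open Finset Filter Topology Set MeasureTheory
open Literature.Probability.LatticeModels Literature.Probability.Percolation

variable {d : ℕ} {q : ℝ} {Φ : ℝ → ℝ} {e₀ : Sym2 (Site d)}

/-! ### The free-energy functional: `|Λ_N|⁻¹ (log Z^b_{Λ_N}(x) − |E_{Λ_N}| log(1−x)) → Φ(x) − d log(1−x)` -/

/-- `|Λ_N|⁻¹ (log Z^b_{Λ_N}(x,q) − |E_{Λ_N}| log(1−x)) → Φ(x) − d log(1−x)` for both boundary conditions (`q ≥ 1`, `x ∈ (0,1)`).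
[cite: Grimmett2006, Thm. (4.58), (4.70)] -/
theorem tendsto_logY_box_div {x : ℝ} (hx : x ∈ Set.Ioo (0 : ℝ) 1) (hq : 1 ≤ q)
    (hΦ : ∀ x ∈ Set.Ioo (0 : ℝ) 1, Tendsto (fun N : ℕ =>
      Real.log (rcPartitionFunction (finsetGraph (zdGraph d) (box d N)) x q (boxBC d false N)) / #(box d N)) atTop (𝓝 (Φ x)))
    (b : Bool) :
    Tendsto (fun N : ℕ => (Real.log (rcPartitionFunction (finsetGraph (zdGraph d) (box d N)) x q (boxBC d b N)) -
        #(finsetGraph (zdGraph d) (box d N)).edgeFinset * Real.log (1 - x)) / #(box d N)) atTop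
      (𝓝 (Φ x - d * Real.log (1 - x))) := by
  have h1 := tendsto_log_rcPartitionFunction_box_div_of_free ⟨hx.1.le, hx.2.le⟩ hq (hΦ x hx) b
  have h2 := (tendsto_card_edgeFinset_box_div_card_box (d := d)).mul_const (Real.log (1 - x))
  refine (h1.sub h2).congr fun N => ?_
  rw [sub_div, mul_div_right_comm]

/-! ### The large-deviation upper bounds -/

/-- **LD UPPER BOUND, UPPER TAIL** (`q ≥ 1`, `p ≤ p'` in `(0,1)`, any `m`, `ε > 0`, free or wired): eventually
`φ^b_{Λ_N,p,q}{m|Λ_N| ≤ |ω|} ≤ exp(−|Λ_N|(tm − ((Φ(p') − d log(1−p')) − (Φ(p) − d log(1−p))) − ε))`, `t = log(p'(1−p)/(p(1−p')))`.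
[cite: Ellis2006, Thm. II.6.1 (b); Grimmett2006, §4.5 (4.70)–(4.72)] -/
theorem rc_ld_upper_box {p p' : ℝ} (hp : p ∈ Set.Ioo (0 : ℝ) 1) (hp' : p' ∈ Set.Ioo (0 : ℝ) 1) (hpp' : p ≤ p') (hq : 1 ≤ q)
    (hΦ : ∀ x ∈ Set.Ioo (0 : ℝ) 1, Tendsto (fun N : ℕ =>
      Real.log (rcPartitionFunction (finsetGraph (zdGraph d) (box d N)) x q (boxBC d false N)) / #(box d N)) atTop (𝓝 (Φ x)))
    (m : ℝ) {ε : ℝ} (hε : 0 < ε) (b : Bool) :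
    ∀ᶠ N : ℕ in atTop,
      (rcMeasure (finsetGraph (zdGraph d) (box d N)) p q (boxBC d b N)).real
          {η : BondConfig ↥(box d N) | m * #(box d N) ≤ (η.ncard : ℝ)} ≤
        Real.exp (-(#(box d N) * (Real.log (p' * (1 - p) / (p * (1 - p'))) * m -
          ((Φ p' - d * Real.log (1 - p')) - (Φ p - d * Real.log (1 - p))) - ε))) := by
  have hq0 : 0 < q := one_pos.trans_le hq
  have hlim := (tendsto_logY_box_div hp' hq hΦ b).sub (tendsto_logY_box_div hp hq hΦ b)
  have hev : ∀ᶠ N : ℕ in atTop, (Real.log (rcPartitionFunction (finsetGraph (zdGraph d) (box d N)) p' q (boxBC d b N)) -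
        #(finsetGraph (zdGraph d) (box d N)).edgeFinset * Real.log (1 - p')) / #(box d N) -
      (Real.log (rcPartitionFunction (finsetGraph (zdGraph d) (box d N)) p q (boxBC d b N)) -
        #(finsetGraph (zdGraph d) (box d N)).edgeFinset * Real.log (1 - p)) / #(box d N) <
      (Φ p' - d * Real.log (1 - p')) - (Φ p - d * Real.log (1 - p)) + ε :=
    hlim.eventually (gt_mem_nhds (by linarith))
  filter_upwards [hev] with N hN
  have hV : (0 : ℝ) < #(box d N) := by exact_mod_cast (box_nonempty d N).card_pos
  refine (rcMeasure_real_le_ncard_le _ hp hp' hpp' hq0 (boxBC d b N) (m * #(box d N))).trans ?_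
  rw [Real.exp_le_exp, ← sub_div, div_lt_iff₀ hV] at *
  nlinarith [hN]

/-- **LD UPPER BOUND, LOWER TAIL** (`p' ≤ p`): eventually
`φ^b_{Λ_N,p,q}{|ω| ≤ m|Λ_N|} ≤ exp(−|Λ_N|(tm − ((Φ(p') − d log(1−p')) − (Φ(p) − d log(1−p))) − ε))` (`t ≤ 0`).
[cite: Ellis2006, Thm. II.6.1 (b); Grimmett2006, §4.5 (4.70)–(4.72)] -/
theorem rc_ld_lower_box {p p' : ℝ} (hp : p ∈ Set.Ioo (0 : ℝ) 1) (hp' : p' ∈ Set.Ioo (0 : ℝ) 1) (hpp' : p' ≤ p) (hq : 1 ≤ q)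
    (hΦ : ∀ x ∈ Set.Ioo (0 : ℝ) 1, Tendsto (fun N : ℕ =>
      Real.log (rcPartitionFunction (finsetGraph (zdGraph d) (box d N)) x q (boxBC d false N)) / #(box d N)) atTop (𝓝 (Φ x)))
    (m : ℝ) {ε : ℝ} (hε : 0 < ε) (b : Bool) :
    ∀ᶠ N : ℕ in atTop,
      (rcMeasure (finsetGraph (zdGraph d) (box d N)) p q (boxBC d b N)).real
          {η : BondConfig ↥(box d N) | (η.ncard : ℝ) ≤ m * #(box d N)} ≤
        Real.exp (-(#(box d N) * (Real.log (p' * (1 - p) / (p * (1 - p'))) * m -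
          ((Φ p' - d * Real.log (1 - p')) - (Φ p - d * Real.log (1 - p))) - ε))) := by
  have hq0 : 0 < q := one_pos.trans_le hq
  have hlim := (tendsto_logY_box_div hp' hq hΦ b).sub (tendsto_logY_box_div hp hq hΦ b)
  have hev : ∀ᶠ N : ℕ in atTop, (Real.log (rcPartitionFunction (finsetGraph (zdGraph d) (box d N)) p' q (boxBC d b N)) -
        #(finsetGraph (zdGraph d) (box d N)).edgeFinset * Real.log (1 - p')) / #(box d N) -
      (Real.log (rcPartitionFunction (finsetGraph (zdGraph d) (box d N)) p q (boxBC d b N)) -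
        #(finsetGraph (zdGraph d) (box d N)).edgeFinset * Real.log (1 - p)) / #(box d N) <
      (Φ p' - d * Real.log (1 - p')) - (Φ p - d * Real.log (1 - p)) + ε :=
    hlim.eventually (gt_mem_nhds (by linarith))
  filter_upwards [hev] with N hN
  have hV : (0 : ℝ) < #(box d N) := by exact_mod_cast (box_nonempty d N).card_pos
  refine (rcMeasure_real_ncard_le_le _ hp hp' hpp' hq0 (boxBC d b N) (m * #(box d N))).trans ?_
  rw [Real.exp_le_exp, ← sub_div, div_lt_iff₀ hV] at *
  nlinarith [hN]

/-! ### Positive rates from the one-sided derivatives of the pressure -/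

/-- A function vanishing at `p` with positive right derivative is positive somewhere in every right neighbourhood. [folklore] -/
theorem exists_Ioo_pos_of_hasDerivWithinAt_Ioi {R : ℝ → ℝ} {p D u : ℝ} (hR : HasDerivWithinAt R D (Set.Ioi p) p) (hD : 0 < D)
    (h0 : R p = 0) (hu : p < u) : ∃ x ∈ Set.Ioo p u, 0 < R x := by
  have hslope : Tendsto (fun t => slope R p t) (𝓝[>] p) (𝓝 D) := by
    have := (hasDerivWithinAt_iff_tendsto_slope' (notMem_Ioi.2 le_rfl)).1 hR
    simpa using this
  have hev : ∀ᶠ t in 𝓝[>] p, 0 < slope R p t := hslope.eventually (lt_mem_nhds hD)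
  obtain ⟨x, hx1, hx2⟩ := (hev.and (Ioo_mem_nhdsGT hu)).exists
  refine ⟨x, hx2, ?_⟩
  rw [slope_def_field, h0, sub_zero] at hx1
  exact (div_pos_iff.1 hx1).elim (fun h => h.1) fun h => absurd h.2 (not_lt.2 (sub_pos.2 hx2.1).le)

/-- A function vanishing at `p` with negative left derivative is positive somewhere in every left neighbourhood. [folklore] -/
theorem exists_Ioo_pos_of_hasDerivWithinAt_Iio {R : ℝ → ℝ} {p D l : ℝ} (hR : HasDerivWithinAt R D (Set.Iio p) p) (hD : D < 0)
    (h0 : R p = 0) (hl : l < p) : ∃ x ∈ Set.Ioo l p, 0 < R x := by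
  have hslope : Tendsto (fun t => slope R p t) (𝓝[<] p) (𝓝 D) := by
    have := (hasDerivWithinAt_iff_tendsto_slope' (notMem_Iio.2 le_rfl)).1 hR
    simpa using this
  have hev : ∀ᶠ t in 𝓝[<] p, slope R p t < 0 := hslope.eventually (gt_mem_nhds hD)
  obtain ⟨x, hx1, hx2⟩ := (hev.and (Ioo_mem_nhdsLT hl)).exists
  refine ⟨x, hx2, ?_⟩
  rw [slope_def_field, h0, sub_zero] at hx1
  exact (div_neg_iff.1 hx1).elim (fun h => h.1) fun h => absurd h.2 (not_lt.2 (sub_neg.2 hx2.2).le)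

/-- `log(p'(1−p)/(p(1−p'))) = (log p' − log(1−p')) − (log p − log(1−p))` (the tilt is the increment of `π = log(p/(1−p))`).
[cite: Grimmett2006, §4.5 (4.56)] -/
theorem log_ratio_eq_logit_sub {p p' : ℝ} (hp : p ∈ Set.Ioo (0 : ℝ) 1) (hp' : p' ∈ Set.Ioo (0 : ℝ) 1) :
    Real.log (p' * (1 - p) / (p * (1 - p'))) = (Real.log p' - Real.log (1 - p')) - (Real.log p - Real.log (1 - p)) := by
  have h1p : 0 < 1 - p := sub_pos.2 hp.2
  have h1p' : 0 < 1 - p' := sub_pos.2 hp'.2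
  rw [Real.log_div (mul_pos hp'.1 h1p).ne' (mul_pos hp.1 h1p').ne', Real.log_mul hp'.1.ne' h1p.ne',
    Real.log_mul hp.1.ne' h1p'.ne']
  ring

/-- The rate functional `x ↦ m(π(x) − π(p)) − (F(x) − F(p))` (`π(x) = log(x/(1−x))`, `F = Φ − d log(1−·)`) has one-sided derivative
`(m − (p(1−p)D + dp))/(p(1−p))·` at `p` when `Φ` has one-sided derivative `D` there. [cite: Grimmett2006, §4.5 (4.70), (4.77)] -/
theorem hasDerivWithinAt_rate {s : Set ℝ} {p D : ℝ} (hp : p ∈ Set.Ioo (0 : ℝ) 1) (hD : HasDerivWithinAt Φ D s p) (m : ℝ) (d : ℕ) :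
    HasDerivWithinAt (fun x => m * ((Real.log x - Real.log (1 - x)) - (Real.log p - Real.log (1 - p))) -
        ((Φ x - d * Real.log (1 - x)) - (Φ p - d * Real.log (1 - p))))
      (m * (p⁻¹ - (-1) / (1 - p)) - (D - d * ((-1) / (1 - p)))) s p := by
  have h1p : (1 : ℝ) - p ≠ 0 := (sub_pos.2 hp.2).ne'
  have hlog : HasDerivWithinAt (fun x => Real.log x) p⁻¹ s p := (Real.hasDerivAt_log hp.1.ne').hasDerivWithinAt
  have hlog1 : HasDerivWithinAt (fun x => Real.log (1 - x)) ((-1) / (1 - p)) s p := by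
    have h := ((hasDerivAt_const p (1 : ℝ)).sub (hasDerivAt_id p)).log h1p
    simp only [zero_sub] at h
    exact h.hasDerivWithinAt
  have h1 := ((hlog.sub hlog1).sub_const (Real.log p - Real.log (1 - p))).const_mul m
  have h2 := (hD.sub (hlog1.const_mul (d : ℝ))).sub_const (Φ p - d * Real.log (1 - p))
  exact h1.sub h2

/-- **SOME UPPER RATE IS POSITIVE ABOVE `d·h¹(p,q)`** (`q ≥ 1`, `p ∈ (0,1)`, `Φ'(p+) = d(h¹ − p)/(p(1−p))`): if `d·h¹(p,q) < m` then for
some `p' ∈ (p,1)`, `0 < tm − ((Φ(p') − d log(1−p')) − (Φ(p) − d log(1−p)))`. [cite: Grimmett2006, (4.77); Ellis2006, Thm. II.6.3 (proof)] -/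
theorem exists_rate_pos_of_lt {p m : ℝ} (hp : p ∈ Set.Ioo (0 : ℝ) 1) (hq : 1 ≤ q) (he₀ : e₀ ∈ (zdGraph d).edgeSet)
    (hΦ : ∀ x ∈ Set.Ioo (0 : ℝ) 1, Tendsto (fun N : ℕ =>
      Real.log (rcPartitionFunction (finsetGraph (zdGraph d) (box d N)) x q (boxBC d false N)) / #(box d N)) atTop (𝓝 (Φ x)))
    (hm : d * wiredEdgeDensity d p q e₀ < m) :
    ∃ p' ∈ Set.Ioo p 1, 0 < Real.log (p' * (1 - p) / (p * (1 - p'))) * m -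
      ((Φ p' - d * Real.log (1 - p')) - (Φ p - d * Real.log (1 - p))) := by
  have hD := hasDerivWithinAt_pressure_Ioi' hp hq he₀ hΦ
  have hR := hasDerivWithinAt_rate hp hD m d
  have hpos : 0 < m * (p⁻¹ - (-1) / (1 - p)) -
      (d * (wiredEdgeDensity d p q e₀ - p) / (p * (1 - p)) - d * ((-1) / (1 - p))) := by
    have hp0 := hp.1
    have h1p : 0 < 1 - p := sub_pos.2 hp.2
    have key : m * (p⁻¹ - (-1) / (1 - p)) - (d * (wiredEdgeDensity d p q e₀ - p) / (p * (1 - p)) - d * ((-1) / (1 - p))) =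
        (m - d * wiredEdgeDensity d p q e₀) / (p * (1 - p)) := by
      field_simp
      ring
    rw [key]
    exact div_pos (sub_pos.2 hm) (mul_pos hp0 h1p)
  obtain ⟨p', hp'I, hpos'⟩ := exists_Ioo_pos_of_hasDerivWithinAt_Ioi hR hpos (by simp) hp.2
  refine ⟨p', hp'I, ?_⟩
  rw [log_ratio_eq_logit_sub hp ⟨hp.1.trans hp'I.1, hp'I.2⟩]
  linarith [hpos', mul_comm m (Real.log p' - Real.log (1 - p') - (Real.log p - Real.log (1 - p)))]

/-- **SOME LOWER RATE IS POSITIVE BELOW `d·h⁰(p,q)`** (`Φ'(p−) = d(h⁰ − p)/(p(1−p))`): if `m < d·h⁰(p,q)` then for some `p' ∈ (0,p)`,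
`0 < tm − ((Φ(p') − d log(1−p')) − (Φ(p) − d log(1−p)))` (`t < 0`). [cite: Grimmett2006, (4.77); Ellis2006, Thm. II.6.3 (proof)] -/
theorem exists_rate_pos_of_gt {p m : ℝ} (hp : p ∈ Set.Ioo (0 : ℝ) 1) (hq : 1 ≤ q) (he₀ : e₀ ∈ (zdGraph d).edgeSet)
    (hΦ : ∀ x ∈ Set.Ioo (0 : ℝ) 1, Tendsto (fun N : ℕ =>
      Real.log (rcPartitionFunction (finsetGraph (zdGraph d) (box d N)) x q (boxBC d false N)) / #(box d N)) atTop (𝓝 (Φ x)))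
    (hm : m < d * freeEdgeDensity d p q e₀) :
    ∃ p' ∈ Set.Ioo 0 p, 0 < Real.log (p' * (1 - p) / (p * (1 - p'))) * m -
      ((Φ p' - d * Real.log (1 - p')) - (Φ p - d * Real.log (1 - p))) := by
  have hD := hasDerivWithinAt_pressure_Iio' hp hq he₀ hΦ
  have hR := hasDerivWithinAt_rate hp hD m d
  have hneg : m * (p⁻¹ - (-1) / (1 - p)) -
      (d * (freeEdgeDensity d p q e₀ - p) / (p * (1 - p)) - d * ((-1) / (1 - p))) < 0 := by
    have hp0 := hp.1
    have h1p : 0 < 1 - p := sub_pos.2 hp.2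
    have key : m * (p⁻¹ - (-1) / (1 - p)) - (d * (freeEdgeDensity d p q e₀ - p) / (p * (1 - p)) - d * ((-1) / (1 - p))) =
        (m - d * freeEdgeDensity d p q e₀) / (p * (1 - p)) := by
      field_simp
      ring
    rw [key]
    exact div_neg_of_neg_of_pos (sub_neg.2 hm) (mul_pos hp0 h1p)
  obtain ⟨p', hp'I, hpos'⟩ := exists_Ioo_pos_of_hasDerivWithinAt_Iio hR hneg (by simp) hp.1
  refine ⟨p', hp'I, ?_⟩
  rw [log_ratio_eq_logit_sub hp ⟨hp'I.1, hp'I.2.trans hp.2⟩]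
  linarith [hpos', mul_comm m (Real.log p' - Real.log (1 - p') - (Real.log p - Real.log (1 - p)))]

/-! ### No edge density above `h¹` or below `h⁰` at volume order -/

/-- **NO EDGE DENSITY ABOVE `h¹(p,q)` AT VOLUME ORDER** (`q ≥ 1`, `p ∈ (0,1)`, `e₀` a lattice edge): if `d·h¹(p,q) < m` then there is
`c > 0` such that, for BOTH boundary conditions, eventually `φ^b_{Λ_N,p,q}{m|Λ_N| ≤ |ω|} ≤ e^{−c|Λ_N|}`.
[cite: Ellis2006, Thm. II.6.1 (b) and Thm. II.6.3; Grimmett2006, Thm. (4.58), (4.77)] -/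
theorem rc_upper_tail_exp_decay {p m : ℝ} (hp : p ∈ Set.Ioo (0 : ℝ) 1) (hq : 1 ≤ q) (he₀ : e₀ ∈ (zdGraph d).edgeSet)
    (hm : d * wiredEdgeDensity d p q e₀ < m) :
    ∃ c : ℝ, 0 < c ∧ ∀ b : Bool, ∀ᶠ N : ℕ in atTop,
      (rcMeasure (finsetGraph (zdGraph d) (box d N)) p q (boxBC d b N)).real
          {η : BondConfig ↥(box d N) | m * #(box d N) ≤ (η.ncard : ℝ)} ≤ Real.exp (-(c * #(box d N))) := by
  obtain ⟨Φ, hΦ⟩ := exists_rcPressure d hq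
  have hΦ' : ∀ x ∈ Set.Ioo (0 : ℝ) 1, Tendsto (fun N : ℕ =>
      Real.log (rcPartitionFunction (finsetGraph (zdGraph d) (box d N)) x q (boxBC d false N)) / #(box d N)) atTop (𝓝 (Φ x)) :=
    fun x hx => hΦ x ⟨hx.1.le, hx.2.le⟩ false
  obtain ⟨p', hp', hrate⟩ := exists_rate_pos_of_lt hp hq he₀ hΦ' hm
  set r := Real.log (p' * (1 - p) / (p * (1 - p'))) * m - ((Φ p' - d * Real.log (1 - p')) - (Φ p - d * Real.log (1 - p)))
  refine ⟨r / 2, half_pos hrate, fun b => ?_⟩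
  filter_upwards [rc_ld_upper_box hp ⟨hp.1.trans hp'.1, hp'.2⟩ hp'.1.le hq hΦ' m (half_pos hrate) b] with N hN
  refine hN.trans (le_of_eq ?_)
  congr 1
  ring

/-- **NO EDGE DENSITY BELOW `h⁰(p,q)` AT VOLUME ORDER**: if `m < d·h⁰(p,q)` then there is `c > 0` such that, for both boundary
conditions, eventually `φ^b_{Λ_N,p,q}{|ω| ≤ m|Λ_N|} ≤ e^{−c|Λ_N|}`. [cite: Ellis2006, Thm. II.6.1 (b) and Thm. II.6.3; Grimmett2006, Thm. (4.58), (4.77)] -/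
theorem rc_lower_tail_exp_decay {p m : ℝ} (hp : p ∈ Set.Ioo (0 : ℝ) 1) (hq : 1 ≤ q) (he₀ : e₀ ∈ (zdGraph d).edgeSet)
    (hm : m < d * freeEdgeDensity d p q e₀) :
    ∃ c : ℝ, 0 < c ∧ ∀ b : Bool, ∀ᶠ N : ℕ in atTop,
      (rcMeasure (finsetGraph (zdGraph d) (box d N)) p q (boxBC d b N)).real
          {η : BondConfig ↥(box d N) | (η.ncard : ℝ) ≤ m * #(box d N)} ≤ Real.exp (-(c * #(box d N))) := by
  obtain ⟨Φ, hΦ⟩ := exists_rcPressure d hq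
  have hΦ' : ∀ x ∈ Set.Ioo (0 : ℝ) 1, Tendsto (fun N : ℕ =>
      Real.log (rcPartitionFunction (finsetGraph (zdGraph d) (box d N)) x q (boxBC d false N)) / #(box d N)) atTop (𝓝 (Φ x)) :=
    fun x hx => hΦ x ⟨hx.1.le, hx.2.le⟩ false
  obtain ⟨p', hp', hrate⟩ := exists_rate_pos_of_gt hp hq he₀ hΦ' hm
  set r := Real.log (p' * (1 - p) / (p * (1 - p'))) * m - ((Φ p' - d * Real.log (1 - p')) - (Φ p - d * Real.log (1 - p)))
  refine ⟨r / 2, half_pos hrate, fun b => ?_⟩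
  filter_upwards [rc_ld_lower_box hp ⟨hp'.1, hp'.2.trans hp.2⟩ hp'.2.le hq hΦ' m (half_pos hrate) b] with N hN
  refine hN.trans (le_of_eq ?_)
  congr 1
  ring

/-- **EXPONENTIAL CONCENTRATION OF THE EDGE DENSITY WHERE `h⁰ = h¹`** (all but countably many `p`; equivalently where the pressure is
differentiable, Thm. (4.63)): if `h⁰(p,q) = h¹(p,q)` then for every `ε > 0` there is `c > 0` with
`φ^b_{Λ_N,p,q}{ε ≤ ||ω|/|Λ_N| − d·h(p,q)|} ≤ e^{−c|Λ_N|}` eventually, for both boundary conditions.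
[cite: Ellis2006, Thm. II.6.3; Grimmett2006, Thm. (4.63)] -/
theorem rc_exp_concentration_of_edgeDensity_eq {p : ℝ} (hp : p ∈ Set.Ioo (0 : ℝ) 1) (hq : 1 ≤ q) (he₀ : e₀ ∈ (zdGraph d).edgeSet)
    (heq : freeEdgeDensity d p q e₀ = wiredEdgeDensity d p q e₀) {ε : ℝ} (hε : 0 < ε) :
    ∃ c : ℝ, 0 < c ∧ ∀ b : Bool, ∀ᶠ N : ℕ in atTop,
      (rcMeasure (finsetGraph (zdGraph d) (box d N)) p q (boxBC d b N)).real
          {η : BondConfig ↥(box d N) | ε ≤ |(η.ncard : ℝ) / #(box d N) - d * wiredEdgeDensity d p q e₀|} ≤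
        Real.exp (-(c * #(box d N))) := by
  have hq0 : 0 < q := one_pos.trans_le hq
  obtain ⟨c₁, hc₁, h₁⟩ := rc_upper_tail_exp_decay hp hq he₀ (m := d * wiredEdgeDensity d p q e₀ + ε) (by linarith)
  obtain ⟨c₂, hc₂, h₂⟩ := rc_lower_tail_exp_decay hp hq he₀ (m := d * wiredEdgeDensity d p q e₀ - ε) (by rw [heq]; linarith)
  obtain ⟨i₀, -, -⟩ := exists_eq_map_add_of_mem_edgeSet he₀
  have hd : 1 ≤ d := i₀.pos
  refine ⟨min c₁ c₂ / 2, by positivity, fun b => ?_⟩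
  filter_upwards [h₁ b, h₂ b, IsingLargeDeviations.eventually_exp_add_exp_le hd hc₁ hc₂] with N hN₁ hN₂ hN
  haveI := isProbabilityMeasure_rcMeasure (finsetGraph (zdGraph d) (box d N)) ⟨hp.1.le, hp.2.le⟩ hq0 (boxBC d b N)
  have hV : (0 : ℝ) < #(box d N) := by exact_mod_cast (box_nonempty d N).card_pos
  have hsub : {η : BondConfig ↥(box d N) | ε ≤ |(η.ncard : ℝ) / #(box d N) - d * wiredEdgeDensity d p q e₀|} ⊆
      {η | (d * wiredEdgeDensity d p q e₀ + ε) * #(box d N) ≤ (η.ncard : ℝ)} ∪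
        {η | (η.ncard : ℝ) ≤ (d * wiredEdgeDensity d p q e₀ - ε) * #(box d N)} := by
    intro η hη
    simp only [mem_setOf_eq, mem_union] at hη ⊢
    rcases le_abs'.1 hη with h | h
    · right
      have h' : (η.ncard : ℝ) / #(box d N) ≤ d * wiredEdgeDensity d p q e₀ - ε := by linarith
      rwa [div_le_iff₀ hV] at h'
    · left
      have h' : d * wiredEdgeDensity d p q e₀ + ε ≤ (η.ncard : ℝ) / #(box d N) := by linarith
      rwa [le_div_iff₀ hV] at h'
  exact ((measureReal_mono hsub).trans (measureReal_union_le _ _)).trans ((add_le_add hN₁ hN₂).trans hN)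

end RandomClusterLargeDeviations

end Summit.CriticalPhenomena.PercolationContinuityZ3.Theorems.FK
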